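import Summits.Langlands.Langlands.Theses.RamifiedCoefficientSeed
import Literature.NumberTheory.GaloisRepresentations.AbsIrreducibleIndexTwo
import Literature.NumberTheory.Automorphic.BCDTModularity

/-!
# Sketch for the TENURE planner (not acted on by this strategist seat): the target X re-typed to the intended strength

`NonPolarisableFamilyAutomorphicR` = the served target `NonPolarisableFamilyAutomorphic` (stmt-Langlands-16777) with the
member-wise clauses of `ExplicitRamifiedFamily` that X omits copied in: (B′) unramified a.e., (C) crystalline at `p` with
labelled Hodge–Tate weights `{0,1,2}` for Fontaine's pinned datum, (E) residually absolutely irreducible over `ℚ(ζ_p)`.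
With these, X is no longer closable in print by Artin monomial witnesses (`Ind` of cubic ray-class characters have
weights `{0,0,0}`), and HT-regular non-essentially-self-dual rank 3 over `ℚ` has no functorial source (Sym² lifts are
essentially self-dual; automorphic induction from a cubic field — cyclic or not — only carries algebraic Hecke
characters of type `Norm^a ·` finite, hence parallel weights `{a,a,a}`), so — in this seat's assessment, not load-bearing
for the audit — even the EXISTENCE of infinitely many twist-classes of automorphic members (non-self-dual cuspidal
cohomology of `GL₃/ℚ` beyond the computed levels 53, 61, 79, 89, … ≤ 337, 521, …) is open in print, which is the route's
(B)-side claim as the thesis states it.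

Checked here (rc 0, 0 sorry): `closesR` — the deciding theorem re-glues with the SAME proof shape;
`targetR_of_family_of_langlands` — modulo the summit the re-typed target is still exactly the existence content of
`ExplicitRamifiedFamily`; `target_of_targetR` — the re-type is a strengthening of the served X.
-/

set_option linter.dupNamespace false

namespace Summit.Langlands.Langlands.Cruxes.SectorComplement.EquivalenceAuditRCS.Restate

open Summit.Langlands.Langlands.Theses.RamifiedCoefficientSeed
open Literature.NumberTheory.GaloisRepresentations
open scoped Matrix
open Filter

/-- Direction (B), `n = 3`, `F = ℚ`, weak form, from the summit (copy of `rcs_weakB_rank3_of_langlands` of the position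
file, inlined so that this sketch elaborates standalone). [folklore] -/
theorem weakB_rank3_of_langlands (hL : _root_.Langlands) (p : ℕ) [Fact p.Prime]
    (ρ : FramedGaloisRep ℚ (PadicAlgCl p) 3)
    (hunr : ∀ᶠ v : IsDedekindDomain.HeightOneSpectrum (NumberField.RingOfIntegers ℚ) in Filter.cofinite,
      ρ.IsUnramifiedAt v)
    (hdR : ∀ (v : IsDedekindDomain.HeightOneSpectrum (NumberField.RingOfIntegers ℚ))
      (hv : ((p : ℕ) : NumberField.RingOfIntegers ℚ) ∈ v.asIdeal),
      (Literature.NumberTheory.PAdicHodge.fontainePstAdicCompletion v p hv).IsDeRhamFramed (ρ.toLocal v))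
    (hirr : (ρ.restrictField (CyclotomicField p ℚ)).IsResiduallyAbsIrreducible)
    (ι : PadicAlgCl p ≃+* ℂ) (hcpt : Literature.NumberTheory.Automorphic.isCompact_glFiniteIntegralLevel 3 ℚ) :
    ∃ π : Literature.NumberTheory.Automorphic.CuspidalAutomorphicRepData 3 ℚ hcpt, π.1.IsLAlgebraic ∧
      ∀ᶠ v : IsDedekindDomain.HeightOneSpectrum (NumberField.RingOfIntegers ℚ) in Filter.cofinite,
        Summit.Langlands.SatakeFrobCompatibleAt ι π.1 ρ v := by
  obtain ⟨⟨𝓡⟩, hGL⟩ := hL ℚ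
  have hB := (hGL 𝓡 3 (by norm_num) hcpt).2
  have habs : FramedRep.IsAbsolutelyIrreducible ρ :=
    FramedGaloisRep.IsAbsolutelyIrreducible.of_restrictField (CyclotomicField p ℚ) ρ
      (FramedGaloisRep.IsResiduallyAbsIrreducible.isAbsolutelyIrreducible three_pos hirr)
  have hirr' : ρ.toGaloisRep.IsIrreducible :=
    (FramedRep.isIrreducible_toContinuousRep_iff ρ).2 habs.isIrreducible
  obtain ⟨π, hLalg, hcorr⟩ := hB p ι ρ hirr' ⟨hunr, fun v hv => hdR v hv⟩
  exact ⟨π, hLalg, hcorr.1⟩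

/-- The re-typed target (proposal for `route edit --restate NonPolarisableFamilyAutomorphic`). -/
def NonPolarisableFamilyAutomorphicR : Prop :=
  ∃ (p : ℕ) (_ : Fact p.Prime), 11 ≤ p ∧ ∃ f : ℕ → Literature.NumberTheory.GaloisRepresentations.FramedGaloisRep ℚ (PadicAlgCl p) 3, (∀ m n, m ≠ n → ¬ ∃ χ : Literature.NumberTheory.GaloisRepresentations.FramedGaloisRep ℚ (PadicAlgCl p) 1, ∀ σ, (f m σ).val.trace = (χ σ).val 0 0 * (f n σ).val.trace) ∧ ∀ n, (¬ ∃ χ : Literature.NumberTheory.GaloisRepresentations.FramedGaloisRep ℚ (PadicAlgCl p) 1, ∀ σ, (f n σ⁻¹).val.trace = (χ σ).val 0 0 * (f n σ).val.trace) ∧ (∀ᶠ v : IsDedekindDomain.HeightOneSpectrum (NumberField.RingOfIntegers ℚ) in Filter.cofinite, (f n).IsUnramifiedAt v) ∧ (∀ (v : IsDedekindDomain.HeightOneSpectrum (NumberField.RingOfIntegers ℚ)) (hv : ((p : ℕ) : NumberField.RingOfIntegers ℚ) ∈ v.asIdeal), let D := Literature.NumberTheory.PAdicHodge.fontainePstAdicCompletion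 v p hv; D.IsCrystallineFramed ((f n).toLocal v) ∧ (letI := D.algebra; ∀ τ : v.adicCompletion ℚ →ₐ[ℚ_[p]] PadicAlgCl p, (f n).labelledHodgeTateWeightsAt v D.algebra D.𝔅 τ.toRingHom = {0, 1, 2})) ∧ ((f n).restrictField (CyclotomicField p ℚ)).IsResiduallyAbsIrreducible ∧ ∀ (ι : PadicAlgCl p ≃+* ℂ) (hcpt : Literature.NumberTheory.Automorphic.isCompact_glFiniteIntegralLevel 3 ℚ), ∃ π : Literature.NumberTheory.Automorphic.CuspidalAutomorphicRepData 3 ℚ hcpt, π.1.IsLAlgebraic ∧ ∀ᶠ v : IsDedekindDomain.HeightOneSpectrum (NumberField.RingOfIntegers ℚ) in Filter.cofinite, Summit.Langlands.SatakeFrobCompatibleAt ι π.1 (f n) v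

/-- The re-typed frame. -/
def SectorComplementR : Prop :=
  NonPolarisableFamilyAutomorphicR → _root_.Langlands

/-- The deciding theorem re-glues with the same shape (what `glue.lean` would become). [folklore] -/
theorem closesR (h1 : ExplicitRamifiedFamily) (h2 : AdjointSeedFromDuality) (h3 : AdjointLiftingGL3)
    (h4 : SectorComplementR) : _root_.Langlands := by
  refine h4 ?_
  obtain ⟨p, hp, h11, f, hne, hf⟩ := h1
  refine ⟨p, hp, h11, f, hne, fun n => ?_⟩
  obtain ⟨hnsd, hunr, hcrys, hdual, hirr, hcc⟩ := hf n
  exact ⟨hnsd, hunr, hcrys, hirr, fun ι hcpt =>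
    h3 p h11 (f n) hunr hcrys hirr (h2 p (le_trans (by norm_num) h11) (f n) hdual hirr hcc) ι hcpt⟩

/-- The re-type strengthens the served target. [folklore] -/
theorem target_of_targetR (h : NonPolarisableFamilyAutomorphicR) : NonPolarisableFamilyAutomorphic := by
  obtain ⟨p, hp, h11, f, hne, hf⟩ := h
  exact ⟨p, hp, h11, f, hne, fun n => (hf n).1, fun n ι hcpt => (hf n).2.2.2.2 ι hcpt⟩

/-- … hence the re-typed frame is formally WEAKER than the served one (still the rest of the summit). [folklore] -/
theorem sectorComplementR_of_sectorComplement (h : SectorComplement) : SectorComplementR :=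
  fun hX ↦ h (target_of_targetR hX)

/-- Modulo the summit, the re-typed target is still exactly the existence content of `ExplicitRamifiedFamily`
(its residual-duality and conjugation clauses unused). [folklore] -/
theorem targetR_of_family_of_langlands (h1 : ExplicitRamifiedFamily) (hL : _root_.Langlands) :
    NonPolarisableFamilyAutomorphicR := by
  obtain ⟨p, hp, h11, f, hne, hf⟩ := h1
  refine ⟨p, hp, h11, f, hne, fun n => ?_⟩
  obtain ⟨hnsd, hunr, hcrys, _hdual, hirr, _hcc⟩ := hf n
  exact ⟨hnsd, hunr, hcrys, hirr, fun ι hcpt =>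
    weakB_rank3_of_langlands hL p (f n) hunr (fun v hv => (hcrys v hv).1.isDeRhamFramed) hirr ι hcpt⟩

/-- Given the explicit family, summit ↔ re-typed target ∧ re-typed frame. [folklore] -/
theorem langlands_iff_targetR_and_sectorComplementR_of_family (h1 : ExplicitRamifiedFamily) :
    _root_.Langlands ↔ NonPolarisableFamilyAutomorphicR ∧ SectorComplementR :=
  ⟨fun hL ↦ ⟨targetR_of_family_of_langlands h1 hL, fun _ ↦ hL⟩, fun h ↦ h.2 h.1⟩

end Summit.Langlands.Langlands.Cruxes.SectorComplement.EquivalenceAuditRCS.Restate
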